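import Literature.NumberTheory.GaloisCohomology.Howard2004.DVRSettingPiRefinementSelmer
import Literature.NumberTheory.GaloisCohomology.Howard2004.DVRSettingPiRefinementResidual
import Literature.NumberTheory.GaloisCohomology.Howard2004.FrobIdealRingChangeProofs
import Literature.NumberTheory.GaloisCohomology.Howard2004.FiniteSingularTameTower
import Literature.NumberTheory.GaloisCohomology.Howard2004.LevelDataCanonical
import HarnessLib

/-!
# Howard 2004, §1.6 with Def. 1.2.3 / Rem. 1.2.4: the Kolyvagin quotients `(T/π^{i+1}T)/I_n` of the
# `π`-adic refinement of a `DVRSetting`, their reductions, and the level data with tame slots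
# (definitions with bodies + theorems)

B. Howard, *The Heegner point Kolyvagin system*, Compositio Math. **140** (2004) (arXiv:1202.6340): §1.6
(p. 11 L45–54: the reductions `T^{(k+1)}/I_n → T^{(k)}/I_n` of the Kolyvagin quotients along the tower),
Def. 1.2.3 and display (ks relations) (p. 6 L120 – p. 7 L12), Rem. 1.2.4 (p. 7 L13–27: `Quot(T)`, `I_ℓ`,
`I_n` are compatible with the change of rings).  Brick (R6a) of the refinement constructor (REFINE, cell
`pub/bsd-print-x9`): the `LevelData` of the refined setting, in the S-CURRENCY fixed with x10b-p1-w8 g10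
(level `i` of the refined setting is `N (S.host hy (i+1)) ⧸ (π^{i+1})` with the quotient action, over
`S.QuotRing (i+1) = R/π^{i+1}` — definitionally `D.Level (i+1)` / `D.levelRep (i+1)` of R1, but spelled so
that Mathlib's `Module (R ⧸ I) (M ⧸ I • ⊤)` is found by instance search).

* §1 `refinedCarrier`, `refinedRep` (abbrevs), finiteness, `refinedRep_isScalarLinear`;
* §2 a generic ring-change inclusion `map_mem_levelIdeal_smul_top_of_ringChange` (instantiating
  `IsQuotientBy.map_levelIdeal_le` of `FrobIdealRingChangeProofs` under local `Algebra`/`Module` structures):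
  along a surjection of modules, semilinear over a surjection of rings, `I_n • (source)` maps into `I_n • (target)`;
* §3 the reduction `refinedRed i : T/π^{i+2} → T/π^{i+1}` (= `D.map`) and its ring-semilinearity, hence
  **`refinedRq i n : (T/π^{i+2})/I_n →ₗ[R] (T/π^{i+1})/I_n`** on the canonical Kolyvagin quotients
  (`LevelData.QuotCarrier`), `refinedRq_mk` (rfl on classes), `refinedRq_equivariant`;
* §4 **`refinedLD pins i : LevelData (S.QuotRing (i+1)) (refinedRep i) (refinedTriple (i+1)) (QuotCarrier …)`** —
  the canonical presentations with the guarded TAME finite–singular slots (LEAD ruling 2026-08-29: the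
  refined setting is tame-pinned by a parameter `pins : ∀ v, TamePin v`), the singular-quotient reductions
  `refinedFsQ` with `refinedFsQ_singularMap` (the clause `fsQ_spec`), and `refinedLD_isFsAdmissible`.

Definitions with bodies and theorems only: no named fact, no instance, no notation, no `sorry`.
`thm161_dvrKolyvaginBound` is NOT proved; BSD is not proved by any of this.
-/

set_option autoImplicit false

noncomputable section

open Function NumberField IsDedekindDomain Field
open scoped NumberField ContRepresentation Classical TensorProduct

namespace Literature.NumberTheory.GaloisCohomology.Howard2004

open Literature.NumberTheory.GaloisRepresentations
open Literature.NumberTheory.GaloisRepresentations.DiscreteGaloisModule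

/-! ## §2 (generic) `I_n • M` maps into `I_n • M'` along a ring change -/

section RingChange

variable {K : Type} [Field K] [NumberField K]
  {A : Type} [CommRing A] {A' : Type} [CommRing A']
  {M : Type} [AddCommGroup M] [TopologicalSpace M] [DiscreteTopology M] [Module A M]
  {M' : Type} [AddCommGroup M'] [TopologicalSpace M'] [DiscreteTopology M'] [Module A' M']

/-- **Along a surjective ring change `φ : A ↠ A'` and an additive equivariant surjection `f : M ↠ M'` with
`f (a • m) = φ a • f m` and `ker f ⊆ (ker φ) • M`, the subgroup `I_n(A, M) • M` maps into `I_n(A', M') • M'`**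
(Rem. 1.2.4: `I_n` is compatible with the change of rings; `FrobIdealRingChangeProofs.map_levelIdeal_le` read
with the structures `φ.toAlgebra`, `Module.compHom M' φ`).
[cite: Howard2004HeegnerKolyvagin, Def. 1.2.1 and Rem. 1.2.4 (arXiv p. 6 L63–75, p. 7 L13–27)] -/
theorem map_mem_levelIdeal_smul_top_of_ringChange (ρ : DiscreteGaloisModule K M) (ρ' : DiscreteGaloisModule K M')
    (φ : A →+* A') (hφ : Surjective φ) (f : M →+ M') (hf : Surjective f)
    (hfs : ∀ (a : A) (m : M), f (a • m) = φ a • f m)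
    (hfe : ∀ (g : absoluteGaloisGroup K) (m : M), f (ρ g m) = ρ' g (f m))
    (hker : ∀ m : M, f m = 0 → m ∈ (RingHom.ker φ) • (⊤ : Submodule A M))
    (n : Finset (HeightOneSpectrum (𝓞 K))) {m : M}
    (hm : m ∈ levelIdeal (R := A) ρ n • (⊤ : Submodule A M)) :
    f m ∈ levelIdeal (R := A') ρ' n • (⊤ : Submodule A' M') := by
  letI : Algebra A A' := φ.toAlgebra
  letI : Module A M' := Module.compHom M' φ
  haveI : IsScalarTower A A' M' := ⟨fun a b x => by
    change (φ a * b) • x = φ a • (b • x)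
    rw [mul_smul]⟩
  have halg : ∀ a : A, algebraMap A A' a = φ a := fun _ => rfl
  let fl : M →ₗ[A] M' :=
    { toFun := f, map_add' := fun x y => map_add f x y, map_smul' := fun a m => hfs a m }
  have hq : IsQuotientBy ρ (RingHom.ker φ) ρ' fl :=
    { surjective := hf
      ker_eq := by
        apply le_antisymm
        · exact fun m hm0 => hker m hm0
        · refine Submodule.smul_le.mpr fun a ha m _ => ?_
          rw [LinearMap.mem_ker]
          change f (a • m) = 0
          rw [hfs, RingHom.mem_ker.mp ha, zero_smul]
      equivariant := hfe }
  have hle := hq.map_levelIdeal_le (le_of_eq rfl) hφ n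
  -- `f (I • M) = (I.map φ) • M' ≤ I' • M'`
  have h1 : f m ∈ ((levelIdeal (R := A) ρ n).map (algebraMap A A')) • (⊤ : Submodule A' M') := by
    have hm' : fl m ∈ ((levelIdeal (R := A) ρ n) • (⊤ : Submodule A M)).map fl := Submodule.mem_map_of_mem hm
    rw [Submodule.map_smul'', Submodule.map_top, LinearMap.range_eq_top.mpr hf] at hm'
    have := (Ideal.smul_restrictScalars (levelIdeal (R := A) ρ n) (⊤ : Submodule A' M')).symm
    rw [Submodule.restrictScalars_top] at this
    rw [this] at hm'
    exact hm'
  exact Submodule.smul_mono_left hle h1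

end RingChange

namespace DVRSetting

variable {p : ℕ} [Fact p.Prime] {K : Type} [Field K] [NumberField K]
  {R : Type} [CommRing R] [IsDomain R] [IsDiscreteValuationRing R] [Algebra ℤ_[p] R]
  {N : ℕ → Type} [∀ k, AddCommGroup (N k)] [∀ k, TopologicalSpace (N k)]
  [∀ k, DiscreteTopology (N k)] [∀ k, Module R (N k)]
  {Rk : ℕ → Type} [∀ k, CommRing (Rk k)] [∀ k, IsLocalRing (Rk k)] [∀ k, TopologicalSpace (Rk k)]
  [∀ k, DiscreteTopology (Rk k)] [∀ k, Algebra ℤ_[p] (Rk k)] [∀ k, Algebra R (Rk k)]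
  [∀ k, Module (Rk k) (N k)] [∀ k, IsScalarTower R (Rk k) (N k)]
  {Nbar : Type} [AddCommGroup Nbar] [TopologicalSpace Nbar] [DiscreteTopology Nbar]
  [∀ k, Module (Rk k) Nbar]
  {Nq : ℕ → Finset (HeightOneSpectrum (𝓞 K)) → Type} [∀ k n, AddCommGroup (Nq k n)]
  [∀ k n, TopologicalSpace (Nq k n)] [∀ k n, DiscreteTopology (Nq k n)]
  [∀ k n, Module (Rk k) (Nq k n)] [∀ k n, Module R (Nq k n)]
  [∀ k n, IsScalarTower R (Rk k) (Nq k n)]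

/-! ## §1 The refined levels in the S-currency -/

/-- **Level `i` of the refined setting, `T/π^{i+1}T = T^{(host)}/π^{i+1}T^{(host)}`** (an `abbrev` of the quotient
module; definitionally `(S.piRefinementDatum hy).Level (i+1)`, spelled with `S.π` / `S.host` so that Mathlib's
`Module (R ⧸ (π^{i+1})) (M ⧸ (π^{i+1}) • M)` is found by instance search). [cite: Howard2004HeegnerKolyvagin, Def. 1.1.3 and §1.6 (arXiv p. 5 L93–99, p. 11 L33–36)] -/
abbrev refinedCarrier (S : DVRSetting p K R N Rk Nbar Nq) (hy : S.SatisfiesH) (i : ℕ) : Type :=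
  N (S.host hy (i + 1)) ⧸ Ideal.span {S.π ^ (i + 1)} • (⊤ : Submodule R (N (S.host hy (i + 1))))

/-- The `Γ_K`-action on level `i` of the refined setting (= `D.levelRep (i+1)` by `rfl`).
[cite: Howard2004HeegnerKolyvagin, Def. 1.1.3 and §1.6 (arXiv p. 5 L93–99, p. 11 L33–36)] -/
abbrev refinedRep (S : DVRSetting p K R N Rk Nbar Nq) (hy : S.SatisfiesH) (i : ℕ) :
    DiscreteGaloisModule K (S.refinedCarrier hy i) :=
  modIdeal (S.T.ρ (S.host hy (i + 1))) (S.T.hlin _) (Ideal.span {S.π ^ (i + 1)})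

/-- The two spellings agree: `refinedRep = D.levelRep (i+1)`. [cite: Howard2004HeegnerKolyvagin, §1.6 (arXiv p. 11, L33–36)] -/
theorem refinedRep_eq_levelRep (S : DVRSetting p K R N Rk Nbar Nq) (hy : S.SatisfiesH) (i : ℕ) :
    S.refinedRep hy i = (S.piRefinementDatum hy).levelRep (i + 1) := rfl

/-- The refined levels are finite. [cite: Howard2004HeegnerKolyvagin, §1.6 (arXiv p. 11, L33–36)] -/
theorem finite_refinedCarrier (S : DVRSetting p K R N Rk Nbar Nq) (hy : S.SatisfiesH) (i : ℕ) :
    Finite (S.refinedCarrier hy i) :=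
  haveI := S.finite_level hy (S.host hy (i + 1))
  Quotient.finite _

/-- The Kolyvagin quotients of the refined levels are finite. [cite: Howard2004HeegnerKolyvagin, Def. 1.2.3 (arXiv p. 7, L1–6)] -/
theorem finite_refinedQuotCarrier (S : DVRSetting p K R N Rk Nbar Nq) (hy : S.SatisfiesH) (i : ℕ)
    (n : Finset (HeightOneSpectrum (𝓞 K))) :
    Finite (LevelData.QuotCarrier (S.QuotRing (i + 1)) (S.refinedRep hy i) n) :=
  haveI := S.finite_refinedCarrier hy i
  Quotient.finite _

/-! ## §3 The reductions of the refined Kolyvagin quotients -/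

/-- The reduction `T/π^{i+2}T ↠ T/π^{i+1}T` of the refined tower (= `(S.refinedTower hy).red i` = `D.map (i+2) (i+1)`).
[cite: Howard2004HeegnerKolyvagin, §1.6 (arXiv p. 11, L33–36)] -/
abbrev refinedRed (S : DVRSetting p K R N Rk Nbar Nq) (hy : S.SatisfiesH) (i : ℕ) :
    S.refinedCarrier hy (i + 1) →ₗ[R] S.refinedCarrier hy i :=
  (S.piRefinementDatum hy).map (i + 1 + 1) (i + 1)

/-- The reduction is semilinear over `R/π^{i+2} ↠ R/π^{i+1}`: `red (⟦r⟧ • x) = ⟦r⟧ • red x`.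
[cite: Howard2004HeegnerKolyvagin, §1.6 and Rem. 1.2.4 (arXiv p. 11 L33–36, p. 7 L19–27)] -/
theorem refinedRed_smul (S : DVRSetting p K R N Rk Nbar Nq) (hy : S.SatisfiesH) (i : ℕ) (r : R)
    (x : S.refinedCarrier hy (i + 1)) :
    S.refinedRed hy i ((Ideal.Quotient.mk (Ideal.span {S.π ^ (i + 1 + 1)}) r) • x) =
      (Ideal.Quotient.mk (Ideal.span {S.π ^ (i + 1)}) r) • S.refinedRed hy i x := by
  obtain ⟨y, rfl⟩ := Submodule.mkQ_surjective _ x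
  change S.refinedRed hy i (Submodule.Quotient.mk (r • y)) = _
  rw [Submodule.Quotient.mk_smul, LinearMap.map_smul]
  rfl

/-- The kernel of the reduction is `π^{i+1} · (T/π^{i+2}T)`, contained in `(ker (R/π^{i+2} → R/π^{i+1})) • ⊤`.
[cite: Howard2004HeegnerKolyvagin, §1.6 (arXiv p. 11, L33–36)] -/
theorem refinedRed_eq_zero (S : DVRSetting p K R N Rk Nbar Nq) (hy : S.SatisfiesH) (i : ℕ)
    (x : S.refinedCarrier hy (i + 1)) (hx : S.refinedRed hy i x = 0) :
    x ∈ (RingHom.ker (Ideal.Quotient.factor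
        (Ideal.span_singleton_le_span_singleton.mpr (pow_dvd_pow S.π (Nat.le_succ (i + 1)))) :
        S.QuotRing (i + 1 + 1) →+* S.QuotRing (i + 1))) • (⊤ : Submodule (S.QuotRing (i + 1 + 1)) (S.refinedCarrier hy (i + 1))) := by
  have h := (S.piRefinementDatum hy).map_eq_zero_iff 1 (i + 1)
  rw [Nat.add_comm 1 (i + 1)] at h
  obtain ⟨z, hz⟩ := (h x).mp hx
  have h1 : (S.piRefinementDatum hy).host 1 ≤ (S.piRefinementDatum hy).host (i + 1 + 1) :=
    (S.piRefinementDatum hy).host_mono (by omega)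
  obtain ⟨w, rfl⟩ := (S.piRefinementDatum hy).proj_surjective h1 z
  rw [(S.piRefinementDatum hy).map_proj 1 (i + 1 + 1) h1 le_rfl, Nat.add_sub_cancel] at hz
  have hx' : x = (Ideal.Quotient.mk (Ideal.span {S.π ^ (i + 1 + 1)}) (S.π ^ (i + 1))) •
      @id (S.refinedCarrier hy (i + 1)) ((S.piRefinementDatum hy).proj le_rfl w) := hz.symm
  rw [hx']
  have hπ : (Ideal.Quotient.mk (Ideal.span {S.π ^ (i + 1 + 1)}) (S.π ^ (i + 1))) ∈ RingHom.ker (Ideal.Quotient.factor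
      (Ideal.span_singleton_le_span_singleton.mpr (pow_dvd_pow S.π (Nat.le_succ (i + 1)))) :
      S.QuotRing (i + 1 + 1) →+* S.QuotRing (i + 1)) := by
    rw [RingHom.mem_ker, Ideal.Quotient.factor_mk, Ideal.Quotient.eq_zero_iff_mem]
    exact Ideal.mem_span_singleton_self _
  exact Submodule.smul_mem_smul hπ Submodule.mem_top

/-- **`I_n • (T/π^{i+2})` reduces into `I_n • (T/π^{i+1})`** (the level ideals over `R/π^{i+2}` and `R/π^{i+1}`;
Rem. 1.2.4). [cite: Howard2004HeegnerKolyvagin, Rem. 1.2.4 and §1.6 (arXiv p. 7 L13–27, p. 11 L45–54)] -/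
theorem refinedRed_mem_levelIdeal_smul_top (S : DVRSetting p K R N Rk Nbar Nq) (hy : S.SatisfiesH) (i : ℕ)
    (n : Finset (HeightOneSpectrum (𝓞 K))) {x : S.refinedCarrier hy (i + 1)}
    (hx : x ∈ levelIdeal (R := S.QuotRing (i + 1 + 1)) (S.refinedRep hy (i + 1)) n •
      (⊤ : Submodule (S.QuotRing (i + 1 + 1)) (S.refinedCarrier hy (i + 1)))) :
    S.refinedRed hy i x ∈ levelIdeal (R := S.QuotRing (i + 1)) (S.refinedRep hy i) n •
      (⊤ : Submodule (S.QuotRing (i + 1)) (S.refinedCarrier hy i)) := by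
  refine map_mem_levelIdeal_smul_top_of_ringChange (S.refinedRep hy (i + 1)) (S.refinedRep hy i)
    (Ideal.Quotient.factor (Ideal.span_singleton_le_span_singleton.mpr (pow_dvd_pow S.π (Nat.le_succ (i + 1)))))
    (Ideal.Quotient.factor_surjective _) (S.refinedRed hy i).toAddMonoidHom ?_ (fun c m => ?_)
    (fun g m => (S.piRefinementDatum hy).map_equivariant _ _ g m) (fun m hm => S.refinedRed_eq_zero hy i m hm) n hx
  · have h := (S.piRefinementDatum hy).map_surjective 1 (i + 1)
    rw [Nat.add_comm 1 (i + 1)] at h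
    exact h
  · obtain ⟨r, rfl⟩ := Ideal.Quotient.mk_surjective c
    rw [Ideal.Quotient.factor_mk]
    exact S.refinedRed_smul hy i r m

/-- **The reduction of the Kolyvagin quotients `(T/π^{i+2})/I_n → (T/π^{i+1})/I_n`** of the refined setting
(`R`-linear; Mathlib `Submodule.mapQ` between the canonical presentations read over `R` through
`Submodule.Quotient.restrictScalarsEquiv`) — the field `rq` of the refined `DVRSetting`.
[cite: Howard2004HeegnerKolyvagin, §1.6 (arXiv p. 11, L49–50) and Def. 1.2.3] -/
def refinedRq (S : DVRSetting p K R N Rk Nbar Nq) (hy : S.SatisfiesH) (i : ℕ) (n : Finset (HeightOneSpectrum (𝓞 K))) :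
    LevelData.QuotCarrier (S.QuotRing (i + 1 + 1)) (S.refinedRep hy (i + 1)) n →ₗ[R]
      LevelData.QuotCarrier (S.QuotRing (i + 1)) (S.refinedRep hy i) n :=
  (Submodule.Quotient.restrictScalarsEquiv R _).toLinearMap ∘ₗ
    Submodule.mapQ _ _ (S.refinedRed hy i) (fun _ hx => S.refinedRed_mem_levelIdeal_smul_top hy i n hx) ∘ₗ
    (Submodule.Quotient.restrictScalarsEquiv R
      ((levelIdeal (R := S.QuotRing (i + 1 + 1)) (S.refinedRep hy (i + 1)) n) •
        (⊤ : Submodule (S.QuotRing (i + 1 + 1)) (S.refinedCarrier hy (i + 1))))).symm.toLinearMap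

/-- On classes `refinedRq` is the reduction: `rq [x] = [red x]`. [cite: Howard2004HeegnerKolyvagin, §1.6 (arXiv p. 11, L49–50)] -/
@[simp] theorem refinedRq_mk (S : DVRSetting p K R N Rk Nbar Nq) (hy : S.SatisfiesH) (i : ℕ)
    (n : Finset (HeightOneSpectrum (𝓞 K))) (x : S.refinedCarrier hy (i + 1)) :
    S.refinedRq hy i n (Submodule.Quotient.mk x) = Submodule.Quotient.mk (S.refinedRed hy i x) := rfl

/-- `refinedRq` is `Γ_K`-equivariant for the quotient actions. [cite: Howard2004HeegnerKolyvagin, §1.6 (arXiv p. 11, L49–50)] -/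
theorem refinedRq_equivariant (S : DVRSetting p K R N Rk Nbar Nq) (hy : S.SatisfiesH) (i : ℕ)
    (n : Finset (HeightOneSpectrum (𝓞 K))) (g : absoluteGaloisGroup K)
    (y : LevelData.QuotCarrier (S.QuotRing (i + 1 + 1)) (S.refinedRep hy (i + 1)) n) :
    S.refinedRq hy i n (modIdeal (S.refinedRep hy (i + 1)) (S.isScalarLinear_modIdeal_quotRing (i + 1 + 1) _)
        (levelIdeal (R := S.QuotRing (i + 1 + 1)) (S.refinedRep hy (i + 1)) n) g y) =
      modIdeal (S.refinedRep hy i) (S.isScalarLinear_modIdeal_quotRing (i + 1) _)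
        (levelIdeal (R := S.QuotRing (i + 1)) (S.refinedRep hy i) n) g (S.refinedRq hy i n y) := by
  obtain ⟨x, rfl⟩ := Submodule.mkQ_surjective _ y
  rw [Submodule.mkQ_apply, modIdeal_apply_mk, refinedRq_mk, refinedRq_mk, modIdeal_apply_mk]
  exact congrArg _ ((S.piRefinementDatum hy).map_equivariant _ _ g x)

/-! ## §4 The level data of the refined setting: canonical presentations with tame slots -/

/-- The actions `(T/π^{i+1})/I_n` are quotients of a free rank-two module over `R/π^{i+1}`, so at the level pairs
`λ ∈ n ∈ 𝓝(𝓛)` Howard's tame hypotheses hold (`tameHyp_of_mem_levels_of_h0` with H.0♯).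
[cite: Howard2004HeegnerKolyvagin, Def. 1.1.8, Def. 1.2.1–1.2.3 and H.0 (arXiv pp. 5–7)] -/
theorem tameHyp_refined (S : DVRSetting p K R N Rk Nbar Nq) (hy : S.SatisfiesH) (i : ℕ)
    (n : Finset (HeightOneSpectrum (𝓞 K))) (v : HeightOneSpectrum (𝓞 K)) (h : n ∈ levels S.L ∧ v ∈ n) :
    TameHyp (LevelData.canonical (S.QuotRing (i + 1)) (S.refinedRep hy i) (S.isScalarLinear_modIdeal_quotRing (i + 1) _)
      (S.refinedTriple hy (i + 1)) (fun _ _ => 0)).ρq n v :=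
  tameHyp_of_mem_levels_of_h0 (S.h0_quotLevel hy (Nat.succ_pos i) (S.le_e_host hy (i + 1))) _ rfl n v h

/-- **The level data of the refined setting at level `i`**: the CANONICAL presentations
`(T/π^{i+1})/I_n := (T/π^{i+1}) ⧸ I_n • (T/π^{i+1})` over `R/π^{i+1}` (`LevelData.canonical`) with the guarded TAME
finite–singular slots of the pin family `pins` (guard `n ∈ 𝓝(𝓛) ∧ λ ∈ n`; LEAD ruling: the refined setting is
tame-pinned). [cite: Howard2004HeegnerKolyvagin, Def. 1.1.8 and Def. 1.2.3 (arXiv p. 5 L126–131, p. 7 L1–12)] -/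
def refinedLD (S : DVRSetting p K R N Rk Nbar Nq) (hy : S.SatisfiesH) (pins : ∀ v : HeightOneSpectrum (𝓞 K), TamePin v)
    (i : ℕ) :
    LevelData (S.QuotRing (i + 1)) (S.refinedRep hy i) (S.refinedTriple hy (i + 1))
      (LevelData.QuotCarrier (S.QuotRing (i + 1)) (S.refinedRep hy i)) :=
  haveI : ∀ n, Finite (LevelData.QuotCarrier (S.QuotRing (i + 1)) (S.refinedRep hy i) n) :=
    fun n => S.finite_refinedQuotCarrier hy i n
  (LevelData.canonical (S.QuotRing (i + 1)) (S.refinedRep hy i) (S.isScalarLinear_modIdeal_quotRing (i + 1) _)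
      (S.refinedTriple hy (i + 1)) (fun _ _ => 0)).withTameSlotOn pins (fun n v => n ∈ levels S.L ∧ v ∈ n)
    (S.tameHyp_refined hy i)

/-- Unfolding: the actions of the refined level data are the canonical quotient actions.
[cite: Howard2004HeegnerKolyvagin, Def. 1.2.3 (arXiv p. 7, L1–6)] -/
theorem refinedLD_ρq (S : DVRSetting p K R N Rk Nbar Nq) (hy : S.SatisfiesH) (pins : ∀ v : HeightOneSpectrum (𝓞 K), TamePin v)
    (i : ℕ) (n : Finset (HeightOneSpectrum (𝓞 K))) :
    (S.refinedLD hy pins i).ρq n =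
      modIdeal (S.refinedRep hy i) (S.isScalarLinear_modIdeal_quotRing (i + 1) _)
        (levelIdeal (R := S.QuotRing (i + 1)) (S.refinedRep hy i) n) := rfl

/-- Unfolding: the presentations of the refined level data are the quotient maps.
[cite: Howard2004HeegnerKolyvagin, Def. 1.2.3 (arXiv p. 7, L1–6)] -/
theorem refinedLD_π (S : DVRSetting p K R N Rk Nbar Nq) (hy : S.SatisfiesH) (pins : ∀ v : HeightOneSpectrum (𝓞 K), TamePin v)
    (i : ℕ) (n : Finset (HeightOneSpectrum (𝓞 K))) (x : S.refinedCarrier hy i) :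
    (S.refinedLD hy pins i).π n x = Submodule.Quotient.mk x := rfl

/-- Unfolding: the slots of the refined level data are the guarded tame slots.
[cite: Howard2004HeegnerKolyvagin, Def. 1.1.8 (arXiv p. 5, L126–131)] -/
theorem refinedLD_fs (S : DVRSetting p K R N Rk Nbar Nq) (hy : S.SatisfiesH) (pins : ∀ v : HeightOneSpectrum (𝓞 K), TamePin v)
    (i : ℕ) :
    haveI : ∀ n, Finite (LevelData.QuotCarrier (S.QuotRing (i + 1)) (S.refinedRep hy i) n) :=
      fun n => S.finite_refinedQuotCarrier hy i n
    (S.refinedLD hy pins i).fs = tameSlotOn pins (S.refinedLD hy pins i).ρq (fun n v => n ∈ levels S.L ∧ v ∈ n)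
      (S.tameHyp_refined hy i) := rfl

/-- **The finite–singular slots of the refined level data are admissible** (Def. 1.1.8: bijective on the finite
classes, natural in the module) — the clause `fs_admissible` of the refined setting.
[cite: Howard2004HeegnerKolyvagin, Def. 1.1.8 and Def. 1.2.3 (arXiv p. 5 L126–131, p. 7 L1–12)] -/
theorem refinedLD_isFsAdmissible (S : DVRSetting p K R N Rk Nbar Nq) (hy : S.SatisfiesH)
    (pins : ∀ v : HeightOneSpectrum (𝓞 K), TamePin v) (i : ℕ) : (S.refinedLD hy pins i).IsFsAdmissible :=
  haveI : ∀ n, Finite (LevelData.QuotCarrier (S.QuotRing (i + 1)) (S.refinedRep hy i) n) :=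
    fun n => S.finite_refinedQuotCarrier hy i n
  (S.refinedLD hy pins i).isFsAdmissible_of_fs_eq_tameSlotOn_levels pins rfl (S.tameHyp_refined hy i) rfl

/-- **The reductions of the singular quotients `H¹_s(K_v, (T/π^{i+2})/I_n) → H¹_s(K_v, (T/π^{i+1})/I_n)`**
induced by `H¹(K_v, rq)` — the field `fsQ` of the refined setting.
[cite: Howard2004HeegnerKolyvagin, Def. 1.2.3 display (ks relations) and §1.6 (arXiv p. 6 L126–140, p. 11 L49–50)] -/
def refinedFsQ (S : DVRSetting p K R N Rk Nbar Nq) (hy : S.SatisfiesH) (pins : ∀ v : HeightOneSpectrum (𝓞 K), TamePin v)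
    (i : ℕ) (n : Finset (HeightOneSpectrum (𝓞 K))) (v : HeightOneSpectrum (𝓞 K)) :
    SingularQuotient (GaloisRep.toLocal v ((S.refinedLD hy pins (i + 1)).ρq n)) →+
      SingularQuotient (GaloisRep.toLocal v ((S.refinedLD hy pins i).ρq n)) :=
  singularQuotientMap ((S.refinedLD hy pins (i + 1)).ρq n) ((S.refinedLD hy pins i).ρq n) v
    (S.refinedRq hy i n).toAddMonoidHom (fun _ y => S.refinedRq_equivariant hy i n _ y)

set_option maxHeartbeats 400000 in
/-- `refinedFsQ` on singular classes: `fsQ (singular x) = singular (H¹(K_v, rq) x)` (with `H¹(K_v, rq)` in the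
`ContinuousRep.cohomologyMap` spelling of `DVRSetting.rqLocH1`).
[cite: Howard2004HeegnerKolyvagin, Def. 1.2.3 display (ks relations) (arXiv p. 6, L126–140)] -/
theorem refinedFsQ_singularMap (S : DVRSetting p K R N Rk Nbar Nq) (hy : S.SatisfiesH)
    (pins : ∀ v : HeightOneSpectrum (𝓞 K), TamePin v) (i : ℕ) (n : Finset (HeightOneSpectrum (𝓞 K)))
    (v : HeightOneSpectrum (𝓞 K)) (x : galoisCohomology (GaloisRep.toLocal v ((S.refinedLD hy pins (i + 1)).ρq n)) 1) :
    S.refinedFsQ hy pins i n v (singularMap _ x) =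
      singularMap _ (ContinuousRep.cohomologyMap (GaloisRep.toLocal v ((S.refinedLD hy pins (i + 1)).ρq n))
        (GaloisRep.toLocal v ((S.refinedLD hy pins i).ρq n)) (S.refinedRq hy i n).toAddMonoidHom
        continuous_of_discreteTopology (fun _ y => S.refinedRq_equivariant hy i n _ y) 1 x) := by
  have hb := cohomologyMap_one_eq_map (GaloisRep.toLocal v ((S.refinedLD hy pins (i + 1)).ρq n))
    (GaloisRep.toLocal v ((S.refinedLD hy pins i).ρq n)) (S.refinedRq hy i n).toAddMonoidHom
    continuous_of_discreteTopology (fun _ y => S.refinedRq_equivariant hy i n _ y)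
    (localIntertwining _ _ v (S.refinedRq hy i n).toAddMonoidHom (fun _ y => S.refinedRq_equivariant hy i n _ y))
    (fun _ => rfl)
  have hx : ContinuousRep.cohomologyMap (GaloisRep.toLocal v ((S.refinedLD hy pins (i + 1)).ρq n))
      (GaloisRep.toLocal v ((S.refinedLD hy pins i).ρq n)) (S.refinedRq hy i n).toAddMonoidHom
      continuous_of_discreteTopology (fun _ y => S.refinedRq_equivariant hy i n _ y) 1 x =
      localH1Map _ _ v (S.refinedRq hy i n).toAddMonoidHom (fun _ y => S.refinedRq_equivariant hy i n _ y) x :=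
    DFunLike.congr_fun hb x
  exact (singularQuotientMap_singularMap _ _ v _ _ x).trans (congrArg (singularMap _) hx.symm)

end DVRSetting

end Literature.NumberTheory.GaloisCohomology.Howard2004

end
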